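import Summits.Ventures.PercRepro.Night2FatXMass
import Summits.Ventures.PercRepro.Night2BasisFatCount

/-!
# night-2: the fat count refined to INDEPENDENT four-subsets

A lossy five-point subset of `V` has rank `5` (`rkN_eq_five_of_lossyBasis`), so it is independent and, with the
fat split, it is `{w₀} ∪ F` or `{x} ∪ F` with `F` an INDEPENDENT four-subset of `(T ∖ K) ∖ {w₀, x}`
(`card_lossy_le_two_mul_indep`).  On the nested-line geometries this is far below `2 · C(|T ∖ K| − 2, 4)`: a
four-subset with three points on a line is dependent.  `pi2MassH_le_fat_indep` and
`basis_pair_fair_of_fat_indep_sum` are the corresponding mass bound and fair-share criterion (the fat case of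
(FAIR) ⇐ `1 ≤ Σ_{T ∋ x, dload T = 0} capS T / ((221/360) · 2 · I₄ (T ∖ K ∖ {w₀, x}))`, `I₄` = the number of
independent four-subsets); numerics: `≥ 1.45` on every fat instance run against `≥ 1.25` for the plain count
(paper `proofs/NIGHT-2-g32.md` §3.7).
-/

namespace PercRepro.Shadow

open PercRepro.ThmH PercRepro.PerFlat

variable {α : Type*} [DecidableEq α] {M : Matroid α} [M.Finite] {G : Finset α}

/-- A lossy five-point subset of `V` is independent. -/
theorem indep_of_lossyBasis (hG : G ∈ flatsQ M (5 + 1)) (hk : kColoops M G = 1) {Q' : Finset α}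
    (hQ'G : Q' ⊆ G \ coloops M G) (hc : Q'.card = 5) (h : lossyBasis M G Q') : M.Indep (Q' : Set α) :=
  indep_of_rkN_eq_card (by rw [rkN_eq_five_of_lossyBasis hG hk hQ'G h, hc])

open scoped Classical in
/-- **At most `2 · I₄` lossy five-point subsets inside a target**, `I₄` = the number of independent four-subsets of
`(T ∖ K) ∖ {w₀, x}`. -/
theorem card_lossy_le_two_mul_indep (hG : G ∈ flatsQ M (5 + 1)) (hd : (gr M \ G).card = 2)
    (hk : kColoops M G = 1) {B₀ : Finset α} (hB₀ : B₀ ∈ thinMembers M 5 G) {w₀ x : α}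
    (hD : G \ clF M B₀ = {w₀, x}) (hne : w₀ ≠ x) {T : Finset α} (hTG : T ⊆ G) :
    (((T \ coloops M G).powersetCard 5).filter (fun Q' => lossyBasis M G Q')).card ≤
      2 * ((((T \ coloops M G) \ {w₀, x}).powersetCard 4).filter (fun F : Finset α => M.Indep (↑F : Set α))).card := by
  set P := (T \ coloops M G) \ {w₀, x} with hP
  set I := (P.powersetCard 4).filter (fun F : Finset α => M.Indep (↑F : Set α)) with hI
  have hsub : ((T \ coloops M G).powersetCard 5).filter (fun Q' => lossyBasis M G Q') ⊆
      I.image (fun F => insert w₀ F) ∪ I.image (fun F => insert x F) := by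
    intro Q' hQ'
    rw [Finset.mem_filter, Finset.mem_powersetCard] at hQ'
    obtain ⟨⟨hQ'T, hQ'5⟩, hlossy⟩ := hQ'
    have hind : M.Indep (Q' : Set α) :=
      indep_of_lossyBasis hG hk (hQ'T.trans (Finset.sdiff_subset_sdiff hTG (Finset.Subset.refl _))) hQ'5 hlossy
    rw [Finset.mem_union, Finset.mem_image, Finset.mem_image]
    rcases lossyBasis_fat_split hG hd hk hB₀ hD hne hlossy with ⟨hw₀Q, hxQ⟩ | ⟨hxQ, hw₀Q⟩
    · left
      refine ⟨Q'.erase w₀, ?_, Finset.insert_erase hw₀Q⟩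
      rw [hI, Finset.mem_filter, Finset.mem_powersetCard, Finset.card_erase_of_mem hw₀Q, hQ'5]
      refine ⟨⟨?_, rfl⟩, hind.subset (by simp)⟩
      intro e he
      rw [Finset.mem_erase] at he
      rw [hP, Finset.mem_sdiff, Finset.mem_insert, Finset.mem_singleton]
      exact ⟨hQ'T he.2, fun h => h.elim he.1 (fun h' => hxQ (h' ▸ he.2))⟩
    · right
      refine ⟨Q'.erase x, ?_, Finset.insert_erase hxQ⟩
      rw [hI, Finset.mem_filter, Finset.mem_powersetCard, Finset.card_erase_of_mem hxQ, hQ'5]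
      refine ⟨⟨?_, rfl⟩, hind.subset (by simp)⟩
      intro e he
      rw [Finset.mem_erase] at he
      rw [hP, Finset.mem_sdiff, Finset.mem_insert, Finset.mem_singleton]
      exact ⟨hQ'T he.2, fun h => h.elim (fun h' => hw₀Q (h' ▸ he.2)) he.1⟩
  calc (((T \ coloops M G).powersetCard 5).filter (fun Q' => lossyBasis M G Q')).card
      ≤ (I.image (fun F => insert w₀ F) ∪ I.image (fun F => insert x F)).card := Finset.card_le_card hsub
    _ ≤ (I.image (fun F => insert w₀ F)).card + (I.image (fun F => insert x F)).card := Finset.card_union_le _ _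
    _ ≤ I.card + I.card := Nat.add_le_add Finset.card_image_le Finset.card_image_le
    _ = 2 * I.card := by ring

open scoped Classical in
/-- **The refined fat-case mass bound** with the independent four-subsets. -/
theorem pi2MassH_le_fat_indep (hG : G ∈ flatsQ M (5 + 1)) (hd : (gr M \ G).card = 2) (hk : kColoops M G = 1)
    (hfat : (fatClosures M 5 G 2).card ≤ 1) {B₀ : Finset α} (hB₀ : B₀ ∈ thinMembers M 5 G) {w₀ x : α}
    (hD : G \ clF M B₀ = {w₀, x}) (hne : w₀ ≠ x) {T : Finset α} (hTG : T ⊆ G) :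
    pi2MassH M 5 G (bigP M G) T ≤
      ((2 * ((((T \ coloops M G) \ {w₀, x}).powersetCard 4).filter (fun F : Finset α => M.Indep (↑F : Set α))).card : ℕ) : ℚ) *
        ((221 / 360) / ((2 ^ (G.card - 6) - 1 : ℕ) : ℚ)) := by
  refine le_trans (pi2MassH_le_lossy_count hG hd hk hfat hTG) ?_
  apply mul_le_mul_of_nonneg_right _ (by positivity)
  exact_mod_cast card_lossy_le_two_mul_indep hG hd hk hB₀ hD hne hTG

open scoped Classical in
/-- **The fat case of (FAIR) from the independent count**: with the fat split `G ∖ clF B₀ = {w₀, x}` of the lossy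
basis pair, `1 ≤ Σ_{T ∈ tgtSets B z, x ∈ T, dload T = 0} capS T / ((221/360) · 2 · I₄ ((T ∖ K) ∖ {w₀, x}))` gives the
pair's fair share. -/
theorem basis_pair_fair_of_fat_indep_sum (hG : G ∈ flatsQ M (5 + 1)) (hd : (gr M \ G).card = 2)
    (hk : kColoops M G = 1) (hs : ∀ e ∈ gr M, ∀ f ∈ gr M, e ≠ f → rkN M {e, f} = 2)
    (hl : ∀ e ∈ gr M, M.Indep {e}) (hfat : (fatClosures M 5 G 2).card ≤ 1)
    {B₀ : Finset α} (hB₀ : B₀ ∈ thinMembers M 5 G) {w₀ x : α} (hD : G \ clF M B₀ = {w₀, x}) (hne : w₀ ≠ x)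
    {B : Finset α} (hB : B ∈ thinMembers M 5 G) (hnP : ¬ bigP M G B) {z : α} (hz : z ∈ G \ clF M B)
    (hl0 : loss M 5 G B z ≠ 0) (hw₀ : w₀ ∈ insert z B) (hx : x ∉ insert z B)
    (hsum : 1 ≤ ∑ T ∈ (tgtSets M 5 G B z).filter
      (fun T => x ∈ T ∧ dload M 5 G (bigP M G) (dshGT2 M 5 G) T = 0),
      capS M 5 G T / ((221 / 360 : ℚ) *
        ((2 * ((((T \ coloops M G) \ {w₀, x}).powersetCard 4).filter (fun F : Finset α => M.Indep (↑F : Set α))).card : ℕ) : ℚ))) :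
    loss M 5 G B z ≤ rhoL M 5 G B z * lossIncomeH M 5 G (bigP M G) (dshGT2 M 5 G) B z := by
  have hd' : (gr M \ G).card ≤ 5 := by omega
  have hB4 := card_sdiff_eq_four_of_not_bigP hG hd hk hB hnP
  have hblock := blocking_of_fat_split hG hd hk hB₀ hD hB hz hw₀ hx
  set 𝒯 := (tgtSets M 5 G B z).filter
    (fun T => x ∈ T ∧ dload M 5 G (bigP M G) (dshGT2 M 5 G) T = 0) with h𝒯
  have h𝒯sub : 𝒯 ⊆ tgtSets M 5 G B z := Finset.filter_subset _ _
  set D : ℚ := ((2 ^ (G.card - 6) - 1 : ℕ) : ℚ) with hDdef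
  have hDpos : 0 < D := by
    rw [hDdef]
    have h7 : 7 ≤ G.card := by
      have hKB : coloops M G ⊆ B := coloops_subset_of_mem_thinMembers hG hd' hB
      have hBG : B ⊆ G := subset_G_of_mem_thinMembers hB
      have h1 := Finset.card_sdiff_add_card_eq_card hKB
      rw [← kColoops_eq_card_coloops, hk] at h1
      have h2 := two_le_card_sdiff_of_not_lay0 hG hd' (mem_thinMembers.1 hB).1 (mem_thinMembers.1 hB).2
      have hdisj : Disjoint B (G \ clF M B) := by
        rw [Finset.disjoint_left]
        intro a ha ha'
        exact (Finset.mem_sdiff.1 ha').2 (subset_clF_of_subset_gr (hBG.trans (mem_flatsQ.1 hG).1) ha)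
      have h3 := Finset.card_le_card (Finset.union_subset hBG (Finset.sdiff_subset : G \ clF M B ⊆ G))
      rw [Finset.card_union_of_disjoint hdisj] at h3
      omega
    have : 2 ≤ 2 ^ (G.card - 6) := by
      calc 2 = 2 ^ 1 := by norm_num
        _ ≤ 2 ^ (G.card - 6) := Nat.pow_le_pow_right (by norm_num) (by omega)
    exact_mod_cast (by omega : 0 < 2 ^ (G.card - 6) - 1)
  have hrho : rhoL M 5 G B z = loss M 5 G B z / D := by
    unfold rhoL
    rw [card_tgtSets hG (mem_thinMembers.1 hB).1 hz,
      card_sdiff_insert_eq_dqm1 (ρ := 5) hG hd' hB (by omega) hz, hk]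
    have hcard : G.card - 1 - 5 = G.card - 6 := by omega
    rw [hcard]
  set c : Finset α → ℚ := fun T => (221 / 360 : ℚ) *
    ((2 * ((((T \ coloops M G) \ {w₀, x}).powersetCard 4).filter (fun F : Finset α => M.Indep (↑F : Set α))).card : ℕ) : ℚ)
    with hc
  set u : Finset α → ℚ := fun T => c T / D with hu
  have hmass : ∀ T ∈ 𝒯, pi2MassH M 5 G (bigP M G) T ≤ u T := by
    intro T hT
    rw [h𝒯, Finset.mem_filter] at hT
    have hTG : T ⊆ G := subset_G_of_mem_shadowAt (mem_tgtSets.1 hT.1).1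
    have := pi2MassH_le_fat_indep hG hd hk hfat hB₀ hD hne hTG
    simp only [hu, hc]
    calc pi2MassH M 5 G (bigP M G) T
        ≤ ((2 * ((((T \ coloops M G) \ {w₀, x}).powersetCard 4).filter
            (fun F : Finset α => M.Indep (↑F : Set α))).card : ℕ) : ℚ) *
          ((221 / 360) / ((2 ^ (G.card - 6) - 1 : ℕ) : ℚ)) := this
      _ = (221 / 360 : ℚ) * ((2 * ((((T \ coloops M G) \ {w₀, x}).powersetCard 4).filter
            (fun F : Finset α => M.Indep (↑F : Set α))).card : ℕ) : ℚ) / D := by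
          rw [hDdef]
          ring
  have hv : ∀ T ∈ 𝒯, capS M 5 G T ≤ cap3 M 5 G (bigP M G) (dshGT2 M 5 G) T := by
    intro T hT
    rw [h𝒯, Finset.mem_filter] at hT
    have hTG : T ⊆ G := subset_G_of_mem_shadowAt (mem_tgtSets.1 hT.1).1
    have hKT : coloops M G ⊆ T := coloops_subset_of_mem_shadowAt (mem_tgtSets.1 hT.1).1
    exact le_trans (capS_le_vCap_of_blocking hG hd hB hz hblock hT.1
      (Finset.singleton_subset_iff.2 hT.2.1) hT.2.2) (vCap_le_cap3 hG hd hk hs hl hfat hTG hKT)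
  have hinc := lossIncomeH_ge_of_subfamily hG hd' (column_side_gt2 hG hd hk hs hl hfat) hB hnP hz hl0
    h𝒯sub u (capS M 5 G) hmass hv (fun T _ => capS_nonneg' hG hd' T)
  have hsplit : ∑ T ∈ 𝒯, capS M 5 G T / u T = D * ∑ T ∈ 𝒯, capS M 5 G T / c T := by
    rw [Finset.mul_sum]
    apply Finset.sum_congr rfl
    intro T _
    simp only [hu]
    by_cases hc0 : c T = 0
    · rw [hc0]
      simp
    · field_simp
  have hD' : D ≤ ∑ T ∈ 𝒯, capS M 5 G T / u T := by
    rw [hsplit]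
    have := mul_le_mul_of_nonneg_left hsum hDpos.le
    linarith
  rw [hrho]
  have hloss0 : 0 ≤ loss M 5 G B z := loss_nonneg (le_trans (by norm_num)
    (capS_ge_eleven_eighteenths_two_one hd hk (Finset.insert_subset (Finset.mem_sdiff.1 hz).1
      (subset_G_of_mem_thinMembers hB))))
  calc loss M 5 G B z = loss M 5 G B z / D * D := by field_simp
    _ ≤ loss M 5 G B z / D * lossIncomeH M 5 G (bigP M G) (dshGT2 M 5 G) B z := by
        apply mul_le_mul_of_nonneg_left (hD'.trans hinc)
        exact div_nonneg hloss0 hDpos.le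

end PercRepro.Shadow
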